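import Summits.QuantumFields.BalabanUV.Beta.GAN24.ChargeTowerInduction

/-!
# `BalabanUV.Beta.GAN24.ChargeTowerExitOrthogonal` — binder row G-an2-4 ∕ (CONV-C), the (S) row ∕ (W-γ) AT EVERY LEVEL («the Δ_j-exact charge tower», road-P2 gen 42, memo
# `HOME/b2b-balaban-gan24-p2/gen41/W-GAMMA-TOWER-v0.md` §8, companion of `ChargeTowerInduction`): **THE MEMO's TARGET AT EVERY LEVEL** — the exit⊗exit charge function of the
# pure S table `S_{j+1}` is `Δ_{j+1}`-EXACT with a BOUNDED, COMB-GAUGED, `Lc`-PERIODIC potential (no constant), hence READS ZERO THROUGH EVERY `ℋ`-COLUMN OF `G_{j+1}`; the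
# exit⊗exit-weighted chain-rule vertex of `S_{j+1}` through `G_{j+1}` vanishes, so does the plain⊗plain ff charge of `S_{j+2}`, and through ANY dressed source `G_{j+1}∘W` the
# charge function reads as «source term + block-constant × multiplier-row totals»

NOT IN PRINT; OUR BOOKKEEPING ([folklore] by name: `ChargeTowerInduction.tower` at `M = 1`, (M1)_{j+1} = `ChargeTowerClimb.tsum_sum_E2image_mul_colH_eq_zero_of_periodic`, leaf-02 g57's
PART D `SrecChargeLamDropsAllLevels.tsum_prod_exitWt_srecAt_eq_spureRecAt`, `ChargeTowerStep.tsum_weighted_vertexOfK` ∕ (I1) `hasSum_prod_coordWeighted_SpureRecAt_succ_inl_inl`,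
`ChargeTowerClimb.abs_tsum_sum_wΦ_mul_le ∕ summable_bdd_mul_colH ∕ ite_and_mul_eq`, my g41 `RelInvWardPairingStep.ward_pairing_coDressKBmAt_KInvStep_succ` (an2's `bhKStep`
relative inverse), leaf-06 g46's `EdgePotentialColumnOrthogonal.contourSum_add_coarse`; 0 `def`, 0 cited fact, 0 `def … : Prop`, 0 sorry).  HONEST FRAMING (cell contract, verbatim):
«discharging `BetaPertH` makes Bałaban's UV stability UNCONDITIONAL — a real constructive-QFT result; it is NOT the continuum limit and NOT the Clay problem.»  HONEST DEPENDENCY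
(verbatim): «continuum YM on T⁴ ⇐ BetaPertH ∧ nine spine estimates (0/9 proved); BetaPertH ⇐ (D1) ∧ (D4) ∧ CAP+tail; G-an2-4 gates asym, D1 and NE2/3/4.»

Notation as in `ChargeTowerInduction`: in-block root `r ∈ box (d+1) Lc`, `ρ = toSite r`, `S_j = SpureRecAt d Lc ρ cE cVH cΛ j`, `G_j = coDressKBmAt ρ Lc (KInvStep Lc j)`,
`(Δ_{j+1} m)(κ,u) = wVH_{j+1}·Σ'_v Σ_l wΦ_{Lc^{j+1}} κ l (u − v)·m l v`, `𝟙^{exit}_a(x) = [x_a % Lc = Lc − 1]`, the exit⊗exit CHARGE FUNCTION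
`C_{j+1}(κ,u) := Σ'_{(x,z)} 𝟙^{exit}_α(x)·𝟙^{exit}_β(z)·S_{j+1} κ u x z (inl α)(inl β)` (`α ≠ β`).
* §1 **`exists_periodic_potential_exitCharge`** (memo §8's statement, `c_n = 0`): for every `j` there is `m` — bounded, `m κ u = 0` on the comb bonds of the root, `m κ (x + Lc•v) = m κ x` —
  with `∀ ν y′, C_{j+1}(ν,y′) = (Δ_{j+1} m)(ν,y′)`; **`…_srecAt`**: the same for the FULL member `SrecAt … (j+1)` (PART D).
* §2 **`tsum_sum_exitCharge_mul_colH_eq_zero`**: `Σ'_u Σ_κ C_{j+1}(κ,u)·colH G_{j+1} Lc ν y′ κ u = 0`, and in the consumer's order **`sum_tsum_colH_mul_exitCharge_eq_zero`**: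
  `Σ_κ Σ'_u colH G_{j+1} Lc ν y′ κ u·C_{j+1}(κ,u) = 0` — (M1)_{j+1}: a bounded comb-gauged `Lc`-periodic potential does not climb.
* §3 CONSEQUENCES one level up: **`tsum_exitWt_vertexOfK_srecAt_eq_zero`** — the exit⊗exit-weighted chain-rule vertex `Σ'_{(y,w)} 𝟙^{exit}_α(y)·(vertexOfK G_{j+1} Lc (SrecAt … (j+1)) ν y′) y w
  (inl α)(inl β)·𝟙^{exit}_β(w) = 0` (`tsum_weighted_vertexOfK` ⨾ PART D ⨾ §2); **`hasSum_plainCharge_SpureRecAt_succ_succ`** — by (I1) with `f ≡ 1` the PLAIN⊗PLAIN ff charge of `S_{j+2}`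
  at every slot is `0`: `HasSum ((x,z) ↦ S_{j+2} ν y′ x z (inl α)(inl β)) 0` (`α ≠ β`, every `j`, every `Lc ≥ 1`) — a second route, through the tower, to the value leaf-04 g63's
  `ThreeFaceRecClosed.hasSum_unitS_SpureRecAt` gives for `3 ≤ Lc` (there at every level; here at levels `≥ 2`).
* §4 `summable_coarse_row`, **`exists_exitCharge_comp_read`** ((M1) FOR ANY SPREAD SOURCE `W`, one potential `m` for all `W`): `Σ'_u Σ_κ C_{j+1}(κ,u)·(G_{j+1}∘W)(u,x)(inl κ, b)
  = Σ'_u Σ_κ m κ u·W u x (inl κ) b + σ_{j+1}·Σ_κ (𝒬_{Lc} m)(κ,0)·Σ'_y (G_{j+1}∘W)(Lc•y, x)(inr κ, b)` — my `RelInvWardPairingStep.ward_pairing_coDressKBmAt_KInvStep_succ` with the block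
  contour sums of the periodic potential constant across blocks: «source term + block-constant × multiplier-row totals»; §2 is `W = idK`.
READING.  (W-γ)'s exit sub-row input at every level `j+1`: the class-𝒞 charge function `exit ⊗ exit` is `Δ_{j+1}`-orthogonal to the `ℋ`-columns — what leaf-06's (γ)∕(α⁺) mechanism
((M1)–(M3), FILES A–F at jb = 0) consumes, now for every `j`.  What this file does NOT supply: the read vectors `r(e) = v_γ + v_{α⁺}` and their pairing one level up, the entry∕slab
classes (engine FALSE), anything of (INV) ∕ (S) ∕ (Q-R) ∕ (LT) ∕ (Q-L) ∕ (C) ∕ «T2Shape» ∕ «T2Drift» ∕ (hW, hWall).  Asserts NO value of Bałaban's tables; NEVER «G-an2-4 closed» as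
(CONV-C); NOT D1, NOT `BetaPertH`, NOT continuum, NOT Clay.  2026-08-22; no existing file touched.
-/

noncomputable section

open Finset
open scoped BigOperators
open Literature.MathematicalPhysics.QuantumFieldTheory
open Literature.MathematicalPhysics.QuantumFieldTheory.Balaban1983to89
open Literature.MathematicalPhysics.QuantumFieldTheory.Balaban1983to89.Beta
open B12Sec2to5 (l1)
open ExpKernelCalculus (Site MKer Decays comp summable_exp_shift')
open AffineAveraging (Form1 box toSite contourSum)
open AveragingContours (blk)
open KernelSpecInstance (wΦ)
open OneStepResolventKernel (Fib)
open OneStepKernelFamily (KInvStep colH vertexOfK)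
open BalabanStepJetsSucc (wVH wE)
open Summit.QuantumFields.BalabanUV.Beta.TameKernelCalculus (Spr)
open Summit.QuantumFields.BalabanUV.Beta.ChartConjugationRelative (spr_comp)
open Summit.QuantumFields.BalabanUV.Beta.AxialDressingRooted (IsCombBondAt coDressKBmAt one_le_of_neZero decays_coDressKBmAt_KInvStep spr_coDressKBmAt)
open Summit.QuantumFields.BalabanUV.Beta.BorderedHessian (stepScale spr_KInvStep)
open Summit.QuantumFields.BalabanUV.Beta.GAN24.EdgePotentialColumnOrthogonal (contourSum_add_coarse)
open Summit.QuantumFields.BalabanUV.Beta.GAN24.RelInvWardPairingStep (ward_pairing_coDressKBmAt_KInvStep_succ)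
open Summit.QuantumFields.BalabanUV.Beta.SpineRooted (SpureRecAt)
open Summit.QuantumFields.BalabanUV.Beta.WardLocusRecursive (SrecAt locStencil_SrecAt)
open Summit.QuantumFields.BalabanUV.Beta.GAN24.SrecChargeLamDropsAllLevels (tsum_prod_exitWt_srecAt_eq_spureRecAt)
open Summit.QuantumFields.BalabanUV.Beta.GAN24.ChargeTowerStep (tsum_weighted_vertexOfK hasSum_prod_coordWeighted_SpureRecAt_succ_inl_inl)
open Summit.QuantumFields.BalabanUV.Beta.GAN24.ChargeTowerClimb (abs_tsum_sum_wΦ_mul_le summable_bdd_mul_colH tsum_sum_E2image_mul_colH_eq_zero_of_periodic ite_and_mul_eq)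
open Summit.QuantumFields.BalabanUV.Beta.GAN24.ChargeTowerInduction (tower abs_exitInd_le_one)

namespace Summit.QuantumFields.BalabanUV.Beta.GAN24.ChargeTowerExitOrthogonal

variable {d : ℕ} {Lc : ℕ} [NeZero Lc] {r : Fin (d + 1) → ℕ}

/-! ## §1 The memo's target (`M = 1`): the pure exit class at every level -/

/-- NOT IN PRINT; OUR BOOKKEEPING.  **`ChargeTowerInduction` — THE exit⊗exit CHARGE FUNCTION OF THE PURE S TABLE IS `Δ`-EXACT AT EVERY LEVEL, WITH A BOUNDED COMB-GAUGED
`Lc`-PERIODIC POTENTIAL AND NO CONSTANT** (in-block root, `α ≠ β`, all `cE cVH cΛ`, every `j`): `∃ m` (bounded; `m κ u = 0` on the comb bonds of the root; `m κ (x + Lc•v) = m κ x`) with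
`∀ ν y′, Σ'_{(x,z)} 𝟙[x_α % Lc = Lc−1]·𝟙[z_β % Lc = Lc−1]·SpureRecAt d Lc ρ cE cVH cΛ (j+1) ν y′ x z (inl α)(inl β) = wVH_{j+1}·Σ'_v Σ_l wΦ_{Lc^{j+1}} ν l (y′ − v)·m l v` — memo §8's statement
with `c_n = 0` (`ChargeTowerInduction.tower` at `M = 1`). -/
theorem exists_periodic_potential_exitCharge (hr : r ∈ box (d + 1) Lc) (cE cVH cΛ : ℝ) {α β : Fin (d + 1)} (hαβ : α ≠ β) (j : ℕ) :
    ∃ m : Form1 (d + 1) ℝ, (∃ B : ℝ, ∀ κ u, |m κ u| ≤ B) ∧ (∀ κ u, IsCombBondAt (toSite r) Lc κ u → m κ u = 0) ∧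
      (∀ κ x v, m κ (x + (Lc : ℤ) • v) = m κ x) ∧
      ∀ (ν : Fin (d + 1)) (y' : Site (d + 1)), ∑' xz : Site (d + 1) × Site (d + 1),
        (if xz.1 α % (Lc : ℤ) = (Lc : ℤ) - 1 then (1 : ℝ) else 0) * (if xz.2 β % (Lc : ℤ) = (Lc : ℤ) - 1 then (1 : ℝ) else 0)
          * SpureRecAt d Lc (toSite r) cE cVH cΛ (j + 1) ν y' xz.1 xz.2 (Sum.inl α) (Sum.inl β)
        = wVH d Lc (j + 1) * ∑' v, ∑ l : Fin (d + 1), wΦ (N := Lc ^ (j + 1)) ν l (y' - v) * m l v := by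
  have h := tower hr cE cVH cΛ hαβ j (M := 1) le_rfl
  simp only [Nat.mul_one] at h
  exact h

/-- NOT IN PRINT; OUR BOOKKEEPING.  **THE SAME FOR THE FULL MEMBER `SrecAt … (j+1)`** (S-pure + `Λ_{j+1}` + border; PART D: the Λ-letter never contributes to a class-𝒟 pair charge). -/
theorem exists_periodic_potential_exitCharge_srecAt (hr : r ∈ box (d + 1) Lc) (cE cVH cΛ : ℝ) {α β : Fin (d + 1)} (hαβ : α ≠ β) (j : ℕ) :
    ∃ m : Form1 (d + 1) ℝ, (∃ B : ℝ, ∀ κ u, |m κ u| ≤ B) ∧ (∀ κ u, IsCombBondAt (toSite r) Lc κ u → m κ u = 0) ∧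
      (∀ κ x v, m κ (x + (Lc : ℤ) • v) = m κ x) ∧
      ∀ (ν : Fin (d + 1)) (y' : Site (d + 1)), ∑' xz : Site (d + 1) × Site (d + 1),
        (if xz.1 α % (Lc : ℤ) = (Lc : ℤ) - 1 then (1 : ℝ) else 0) * (if xz.2 β % (Lc : ℤ) = (Lc : ℤ) - 1 then (1 : ℝ) else 0)
          * SrecAt d Lc (toSite r) cE cVH cΛ (j + 1) ν y' xz.1 xz.2 (Sum.inl α) (Sum.inl β)
        = wVH d Lc (j + 1) * ∑' v, ∑ l : Fin (d + 1), wΦ (N := Lc ^ (j + 1)) ν l (y' - v) * m l v := by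
  classical
  have hLc : 1 ≤ Lc := one_le_of_neZero Lc
  obtain ⟨m, hB, hm0, hper, hT⟩ := exists_periodic_potential_exitCharge hr cE cVH cΛ hαβ j
  refine ⟨m, hB, hm0, hper, fun ν y' => ?_⟩
  -- PART D with the constant weight `f ≡ 1`: `𝟙^{exit,Lc}_a(x)·1`
  have hD := tsum_prod_exitWt_srecAt_eq_spureRecAt hLc hr cE cVH cΛ (j + 1) (f₁ := fun _ : ℤ => (1 : ℝ)) (f₂ := fun _ : ℤ => (1 : ℝ))
    (B₁ := 1) (B₂ := 1) (fun _ => by rw [abs_one]) (fun _ => by rw [abs_one]) ν y' α β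
  rw [hD]
  exact hT ν y'

/-! ## §2 Orthogonality to every `ℋ`-column: (M1) at every level -/

/-- NOT IN PRINT; OUR BOOKKEEPING.  **THE exit⊗exit CHARGE FUNCTION OF `S_{j+1}` READS ZERO THROUGH EVERY `ℋ`-COLUMN OF `G_{j+1}`, AT EVERY LEVEL** (in-block root, `α ≠ β`, all
`cE cVH cΛ`, every `j`, every coarse bond `(ν, y′)`): with `C_{j+1}(κ,u) := Σ'_{(x,z)} 𝟙[x_α % Lc = Lc−1]·𝟙[z_β % Lc = Lc−1]·SpureRecAt … (j+1) κ u x z (inl α)(inl β)`,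
`Σ'_u Σ_κ C_{j+1}(κ,u)·colH G_{j+1} Lc ν y′ κ u = 0` — §1 ⨾ (M1)_{j+1} `ChargeTowerClimb.tsum_sum_E2image_mul_colH_eq_zero_of_periodic` (a bounded comb-gauged `Lc`-periodic potential does
not climb).  The input of leaf-06's (γ)∕(α⁺) mechanism for the exit class, one level up, for every `j`. -/
theorem tsum_sum_exitCharge_mul_colH_eq_zero (hr : r ∈ box (d + 1) Lc) (cE cVH cΛ : ℝ) {α β : Fin (d + 1)} (hαβ : α ≠ β) (j : ℕ)
    (ν : Fin (d + 1)) (y' : Site (d + 1)) :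
    ∑' u, ∑ κ, (∑' xz : Site (d + 1) × Site (d + 1),
        (if xz.1 α % (Lc : ℤ) = (Lc : ℤ) - 1 then (1 : ℝ) else 0) * (if xz.2 β % (Lc : ℤ) = (Lc : ℤ) - 1 then (1 : ℝ) else 0)
          * SpureRecAt d Lc (toSite r) cE cVH cΛ (j + 1) κ u xz.1 xz.2 (Sum.inl α) (Sum.inl β))
        * colH (coDressKBmAt (toSite r) Lc (KInvStep (d := d) Lc (j + 1))) Lc ν y' κ u = 0 := by
  obtain ⟨m, ⟨B, hmB⟩, hm0, hper, hT⟩ := exists_periodic_potential_exitCharge hr cE cVH cΛ hαβ j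
  simp only [hT]
  exact tsum_sum_E2image_mul_colH_eq_zero_of_periodic hr j hmB hm0 hper ν y'

/-- NOT IN PRINT; OUR BOOKKEEPING.  The same in the consumer's order `Σ_κ Σ'_u colH·C` (the shape `ChargeTowerStep.tsum_weighted_vertexOfK` produces), summability from the bounded
exact field against the decaying column (`summable_bdd_mul_colH`). -/
theorem sum_tsum_colH_mul_exitCharge_eq_zero (hr : r ∈ box (d + 1) Lc) (cE cVH cΛ : ℝ) {α β : Fin (d + 1)} (hαβ : α ≠ β) (j : ℕ)
    (ν : Fin (d + 1)) (y' : Site (d + 1)) :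
    ∑ κ, ∑' u, colH (coDressKBmAt (toSite r) Lc (KInvStep (d := d) Lc (j + 1))) Lc ν y' κ u
        * (∑' xz : Site (d + 1) × Site (d + 1),
          (if xz.1 α % (Lc : ℤ) = (Lc : ℤ) - 1 then (1 : ℝ) else 0) * (if xz.2 β % (Lc : ℤ) = (Lc : ℤ) - 1 then (1 : ℝ) else 0)
            * SpureRecAt d Lc (toSite r) cE cVH cΛ (j + 1) κ u xz.1 xz.2 (Sum.inl α) (Sum.inl β)) = 0 := by
  classical
  obtain ⟨m, ⟨B, hmB⟩, hm0, hper, hT⟩ := exists_periodic_potential_exitCharge hr cE cVH cΛ hαβ j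
  simp only [hT]
  -- the exact field is bounded, hence summable against the column; exchange the sums
  have hB0 : 0 ≤ B := (abs_nonneg _).trans (hmB 0 0)
  set E : Form1 (d + 1) ℝ := fun κ u => wVH d Lc (j + 1) * ∑' v, ∑ l : Fin (d + 1), wΦ (N := Lc ^ (j + 1)) κ l (u - v) * m l v with hE
  set BE : ℝ := |wVH d Lc (j + 1)| * (B * ∑ κ : Fin (d + 1), ∑ l : Fin (d + 1), ∑' z : Site (d + 1), |wΦ (N := Lc ^ (j + 1)) κ l z|) with hBE
  have hEb : ∀ κ u, |E κ u| ≤ BE := by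
    intro κ u
    simp only [hE, hBE]
    rw [abs_mul]
    refine mul_le_mul_of_nonneg_left ((abs_tsum_sum_wΦ_mul_le (Lc ^ (j + 1)) hmB κ u).trans
      (mul_le_mul_of_nonneg_left ?_ hB0)) (abs_nonneg _)
    exact Finset.single_le_sum (f := fun κ => ∑ l : Fin (d + 1), ∑' z : Site (d + 1), |wΦ (N := Lc ^ (j + 1)) κ l z|)
      (fun κ _ => Finset.sum_nonneg fun l _ => tsum_nonneg fun z => abs_nonneg _) (Finset.mem_univ κ)
  have hsE : ∀ κ, Summable fun u => E κ u * colH (coDressKBmAt (toSite r) Lc (KInvStep (d := d) Lc (j + 1))) Lc ν y' κ u := fun κ =>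
    summable_bdd_mul_colH hr (j + 1) hEb ν y' κ
  have e1 : ∀ κ, ∑' u, colH (coDressKBmAt (toSite r) Lc (KInvStep (d := d) Lc (j + 1))) Lc ν y' κ u * E κ u
      = ∑' u, E κ u * colH (coDressKBmAt (toSite r) Lc (KInvStep (d := d) Lc (j + 1))) Lc ν y' κ u := fun κ =>
    tsum_congr fun u => mul_comm _ _
  rw [show (fun κ => ∑' u, colH (coDressKBmAt (toSite r) Lc (KInvStep (d := d) Lc (j + 1))) Lc ν y' κ u
      * (wVH d Lc (j + 1) * ∑' v, ∑ l : Fin (d + 1), wΦ (N := Lc ^ (j + 1)) κ l (u - v) * m l v))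
      = fun κ => ∑' u, colH (coDressKBmAt (toSite r) Lc (KInvStep (d := d) Lc (j + 1))) Lc ν y' κ u * E κ u from rfl]
  simp only [e1]
  rw [← Summable.tsum_finsetSum (fun κ _ => hsE κ)]
  exact tsum_sum_E2image_mul_colH_eq_zero_of_periodic hr j hmB hm0 hper ν y'


/-! ## §3 Consequences one level up: the weighted vertex and the plain⊗plain charge of `S_{j+2}` -/

/-- NOT IN PRINT; OUR BOOKKEEPING.  **THE exit⊗exit-WEIGHTED CHAIN-RULE VERTEX OF THE FULL MEMBER THROUGH `G_{j+1}` VANISHES** (in-block root, `α ≠ β`, all `cE cVH cΛ`, every `j`, every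
coarse bond `(ν, y′)`): `Σ'_{(y,w)} 𝟙^{exit}_α(y)·(vertexOfK G_{j+1} Lc (SrecAt … (j+1)) ν y′) y w (inl α)(inl β)·𝟙^{exit}_β(w) = 0` — `ChargeTowerStep.tsum_weighted_vertexOfK` unfolds the vertex
into the `ℋ`-column read of the charge function of `SrecAt … (j+1)`, PART D replaces the full member by the pure one, §2 reads zero. -/
theorem tsum_exitWt_vertexOfK_srecAt_eq_zero (hr : r ∈ box (d + 1) Lc) (cE cVH cΛ : ℝ) {α β : Fin (d + 1)} (hαβ : α ≠ β) (j : ℕ)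
    (ν : Fin (d + 1)) (y' : Site (d + 1)) :
    ∑' yw : Site (d + 1) × Site (d + 1), (if yw.1 α % (Lc : ℤ) = (Lc : ℤ) - 1 then (1 : ℝ) else 0)
        * vertexOfK (coDressKBmAt (toSite r) Lc (KInvStep (d := d) Lc (j + 1))) Lc (SrecAt d Lc (toSite r) cE cVH cΛ (j + 1)) ν y' yw.1 yw.2 (Sum.inl α) (Sum.inl β)
        * (if yw.2 β % (Lc : ℤ) = (Lc : ℤ) - 1 then (1 : ℝ) else 0) = 0 := by
  classical
  have hLc : 1 ≤ Lc := one_le_of_neZero Lc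
  obtain ⟨δ, C, hδ, -, hG⟩ := decays_coDressKBmAt_KInvStep (d := d) hr (j + 1)
  obtain ⟨Cs, δs, hδs, hS⟩ := locStencil_SrecAt (d := d) (Lc := Lc) hLc hr cE cVH cΛ (j + 1)
  rw [tsum_weighted_vertexOfK hLc hG hδ hS hδs ν y' (fun y : Site (d + 1) => if y α % (Lc : ℤ) = (Lc : ℤ) - 1 then (1 : ℝ) else 0)
    (fun w : Site (d + 1) => if w β % (Lc : ℤ) = (Lc : ℤ) - 1 then (1 : ℝ) else 0) (fun y => abs_exitInd_le_one _ (y α)) (fun w => abs_exitInd_le_one _ (w β))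
    (Sum.inl α) (Sum.inl β)]
  -- PART D with the constant inner weight `f ≡ 1`
  have hD : ∀ (κ : Fin (d + 1)) (u : Site (d + 1)), ∑' xz : Site (d + 1) × Site (d + 1),
      (if xz.1 α % (Lc : ℤ) = (Lc : ℤ) - 1 then (1 : ℝ) else 0) * (if xz.2 β % (Lc : ℤ) = (Lc : ℤ) - 1 then (1 : ℝ) else 0)
        * SrecAt d Lc (toSite r) cE cVH cΛ (j + 1) κ u xz.1 xz.2 (Sum.inl α) (Sum.inl β)
      = ∑' xz : Site (d + 1) × Site (d + 1),
        (if xz.1 α % (Lc : ℤ) = (Lc : ℤ) - 1 then (1 : ℝ) else 0) * (if xz.2 β % (Lc : ℤ) = (Lc : ℤ) - 1 then (1 : ℝ) else 0)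
          * SpureRecAt d Lc (toSite r) cE cVH cΛ (j + 1) κ u xz.1 xz.2 (Sum.inl α) (Sum.inl β) := fun κ u =>
    tsum_prod_exitWt_srecAt_eq_spureRecAt hLc hr cE cVH cΛ (j + 1) (f₁ := fun _ : ℤ => (1 : ℝ)) (f₂ := fun _ : ℤ => (1 : ℝ))
      (B₁ := 1) (B₂ := 1) (fun _ => by rw [abs_one]) (fun _ => by rw [abs_one]) κ u α β
  simp only [hD]
  exact sum_tsum_colH_mul_exitCharge_eq_zero hr cE cVH cΛ hαβ j ν y'

/-- NOT IN PRINT; OUR BOOKKEEPING.  **THE PLAIN⊗PLAIN ff CHARGE OF `S_{j+2}` VANISHES AT EVERY SLOT** (in-block root, `α ≠ β`, all `cE cVH cΛ`, every `j`, every `Lc ≥ 1`):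
`HasSum ((x,z) ↦ SpureRecAt … (j+2) ν y′ x z (inl α)(inl β)) 0` — (I1) `ChargeTowerStep.hasSum_prod_coordWeighted_SpureRecAt_succ_inl_inl` with `f₁ = f₂ ≡ 1` (the plain class pulls
back to the exit class) ⨾ the weighted vertex is `0`.  A second route, through the tower, to `hζS` with `ζS = 0` (leaf-04 g63's `ThreeFaceRecClosed.hasSum_unitS_SpureRecAt`: every
level, `3 ≤ Lc`; here levels `≥ 2`, every `Lc`). -/
theorem hasSum_plainCharge_SpureRecAt_succ_succ (hr : r ∈ box (d + 1) Lc) (cE cVH cΛ : ℝ) {α β : Fin (d + 1)} (hαβ : α ≠ β) (j : ℕ)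
    (ν : Fin (d + 1)) (y' : Site (d + 1)) :
    HasSum (fun xz : Site (d + 1) × Site (d + 1) => SpureRecAt d Lc (toSite r) cE cVH cΛ (j + 2) ν y' xz.1 xz.2 (Sum.inl α) (Sum.inl β)) 0 := by
  classical
  have h := hasSum_prod_coordWeighted_SpureRecAt_succ_inl_inl hr cE cVH cΛ (j + 1) ν y' α β (fun _ : ℤ => (1 : ℝ)) (fun _ : ℤ => (1 : ℝ))
    (B₁ := 1) (B₂ := 1) (fun _ => by rw [abs_one]) (fun _ => by rw [abs_one])
  have hV : (∑' yw : Site (d + 1) × Site (d + 1),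
      (if yw.1 α % (Lc : ℤ) = (Lc : ℤ) - 1 ∧ yw.2 β % (Lc : ℤ) = (Lc : ℤ) - 1 then
        (1 : ℝ) * 1 * vertexOfK (coDressKBmAt (toSite r) Lc (KInvStep (d := d) Lc (j + 1))) Lc (SrecAt d Lc (toSite r) cE cVH cΛ (j + 1)) ν y' yw.1 yw.2
          (Sum.inl α) (Sum.inl β) else 0)) = 0 := by
    refine Eq.trans (tsum_congr fun yw => ?_) (tsum_exitWt_vertexOfK_srecAt_eq_zero hr cE cVH cΛ hαβ j ν y')
    rw [ite_and_mul_eq]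
  rw [hV, mul_zero, mul_zero] at h
  refine h.congr_fun fun xz => ?_
  show _ = _
  rw [one_mul, one_mul]

/-! ## §4 (M1) for ANY sparse source: the exact part read through `G_{j+1} ∘ W` -/

/-- [folklore] A multiplier row of a spread kernel is summable along the coarse index: `y ↦ V (Lc•y) x (inr κ) b` (decay + injectivity of `y ↦ Lc•y`). -/
theorem summable_coarse_row {V : MKer (d + 1) (Fib d)} (hV : Spr V) (x : Site (d + 1)) (κ : Fin (d + 1)) (b : Fib d) :
    Summable fun y : Site (d + 1) => V ((Lc : ℤ) • y) x (Sum.inr κ) b := by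
  obtain ⟨C, δ, hδ, hD⟩ := hV
  have hinj : Function.Injective fun y : Site (d + 1) => (Lc : ℤ) • y :=
    smul_right_injective (Site (d + 1)) (by exact_mod_cast NeZero.ne Lc : (Lc : ℤ) ≠ 0)
  have hs : Summable fun y : Site (d + 1) => C * Real.exp (-δ * l1 ((Lc : ℤ) • y - x)) := by
    have h := ((summable_exp_shift' hδ x).comp_injective hinj).mul_left C
    simpa only [Function.comp_def] using h
  refine Summable.of_norm_bounded hs (fun y => ?_)
  rw [Real.norm_eq_abs]
  exact hD _ _ _ _

/-- NOT IN PRINT; OUR BOOKKEEPING.  **(M1) FOR ANY SPARSE SOURCE `W`** (in-block root, `α ≠ β`, all `cE cVH cΛ`, every `j`): there is ONE potential `m` — bounded, zero on the comb bonds,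
`Lc`-periodic, with `C_{j+1} = Δ_{j+1} m` (§1) — such that for EVERY spread source `W`, every target `(x, b)`,
`Σ'_u Σ_κ C_{j+1}(κ,u)·(G_{j+1}∘W)(u,x)(inl κ, b) = Σ'_u Σ_κ m κ u·W u x (inl κ) b + σ_{j+1}·Σ_κ (𝒬_{Lc} m)(κ,0)·Σ'_y (G_{j+1}∘W)(Lc•y, x)(inr κ, b)` — my level-(j+1) Ward pairing
`RelInvWardPairingStep.ward_pairing_coDressKBmAt_KInvStep_succ` with the block contour sums of the periodic potential CONSTANT across blocks (`contourSum_add_coarse`): the exact part of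
the exit⊗exit charge reads through any dressed source as «source term + block-constant × multiplier-row totals».  §2 is the instance `W = idK`, `x` a coarse multiplier point (source term `0`,
totals `Σ'_y E2 = 0`).  The shape the (γ)∕(α⁺) read weights one level up are built from (leaf-06 FILE E's `w^{(γ)} = (G₀∘𝒟(e))·gaugeWt` at jb = 0). -/
theorem exists_exitCharge_comp_read (hr : r ∈ box (d + 1) Lc) (cE cVH cΛ : ℝ) {α β : Fin (d + 1)} (hαβ : α ≠ β) (j : ℕ) :
    ∃ m : Form1 (d + 1) ℝ, (∃ B : ℝ, ∀ κ u, |m κ u| ≤ B) ∧ (∀ κ u, IsCombBondAt (toSite r) Lc κ u → m κ u = 0) ∧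
      (∀ κ x v, m κ (x + (Lc : ℤ) • v) = m κ x) ∧
      (∀ (ν : Fin (d + 1)) (y' : Site (d + 1)), ∑' xz : Site (d + 1) × Site (d + 1),
        (if xz.1 α % (Lc : ℤ) = (Lc : ℤ) - 1 then (1 : ℝ) else 0) * (if xz.2 β % (Lc : ℤ) = (Lc : ℤ) - 1 then (1 : ℝ) else 0)
          * SpureRecAt d Lc (toSite r) cE cVH cΛ (j + 1) ν y' xz.1 xz.2 (Sum.inl α) (Sum.inl β)
        = wVH d Lc (j + 1) * ∑' v, ∑ l : Fin (d + 1), wΦ (N := Lc ^ (j + 1)) ν l (y' - v) * m l v) ∧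
      ∀ {W : MKer (d + 1) (Fib d)}, Spr W → ∀ (x : Site (d + 1)) (b : Fib d),
        ∑' u, ∑ κ, (∑' xz : Site (d + 1) × Site (d + 1),
            (if xz.1 α % (Lc : ℤ) = (Lc : ℤ) - 1 then (1 : ℝ) else 0) * (if xz.2 β % (Lc : ℤ) = (Lc : ℤ) - 1 then (1 : ℝ) else 0)
              * SpureRecAt d Lc (toSite r) cE cVH cΛ (j + 1) κ u xz.1 xz.2 (Sum.inl α) (Sum.inl β))
            * comp (coDressKBmAt (toSite r) Lc (KInvStep (d := d) Lc (j + 1))) W u x (Sum.inl κ) b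
          = (∑' u, ∑ κ, m κ u * W u x (Sum.inl κ) b)
            + stepScale d Lc (j + 1) * ∑ κ : Fin (d + 1), contourSum Lc m κ 0
              * ∑' y : Site (d + 1), comp (coDressKBmAt (toSite r) Lc (KInvStep (d := d) Lc (j + 1))) W ((Lc : ℤ) • y) x (Sum.inr κ) b := by
  classical
  have hLc : 1 ≤ Lc := one_le_of_neZero Lc
  obtain ⟨m, ⟨B, hmB⟩, hm0, hper, hT⟩ := exists_periodic_potential_exitCharge hr cE cVH cΛ hαβ j
  refine ⟨m, ⟨B, hmB⟩, hm0, hper, hT, fun {W} hWs x b => ?_⟩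
  simp only [hT]
  rw [ward_pairing_coDressKBmAt_KInvStep_succ hr j hWs hmB hm0 x b]
  congr 1
  -- the block contour sums of the periodic potential do not depend on the block
  have hq : ∀ κ y, contourSum Lc m κ y = contourSum Lc m κ 0 := fun κ y => by
    have h := contourSum_add_coarse (L := Lc) hper κ 0 y
    rwa [zero_add] at h
  have hs : ∀ κ, Summable fun y : Site (d + 1) =>
      comp (coDressKBmAt (toSite r) Lc (KInvStep (d := d) Lc (j + 1))) W ((Lc : ℤ) • y) x (Sum.inr κ) b := fun κ =>
    summable_coarse_row (spr_comp (spr_coDressKBmAt hLc hr (spr_KInvStep (j + 1))) hWs) x κ b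
  have e : ∀ y : Site (d + 1), ∑ κ, contourSum Lc m κ y * comp (coDressKBmAt (toSite r) Lc (KInvStep (d := d) Lc (j + 1))) W ((Lc : ℤ) • y) x (Sum.inr κ) b
      = ∑ κ, contourSum Lc m κ 0 * comp (coDressKBmAt (toSite r) Lc (KInvStep (d := d) Lc (j + 1))) W ((Lc : ℤ) • y) x (Sum.inr κ) b := fun y =>
    Finset.sum_congr rfl fun κ _ => by rw [hq κ y]
  congr 1
  rw [tsum_congr e, Summable.tsum_finsetSum (fun κ _ => (hs κ).mul_left _)]
  exact Finset.sum_congr rfl fun κ _ => tsum_mul_left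

end Summit.QuantumFields.BalabanUV.Beta.GAN24.ChargeTowerExitOrthogonal

end
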